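import Summits.Schanuel.Schanuel.Theorems.RootDecomp1HMirrorCore

/-!
# RootDecomp1HSigmaAx — ROUND 13 «Σ» of route `RootDecomp1H` (cell decomp-schanuel, lens 5, generation 13), part 1 of 2

**Khovanskii point OR Ax constants** (`khovanskii_or_constants`): the landed
`MinimalCounterexampleInAcl.Negative.firstFailure_khovanskii` (Kirby 2010 Lemma 4.8 + Ax 1971 Thm 3 with its rank term + the
tower law) with BOTH first-failure hypotheses removed and the contradiction branch returned as DATA — for a `ℚ`-free `x ∈ ℂⁿ`,
either `(x, eˣ)` is a non-degenerate Khovanskii point of its own `ℚ`-locus, or some `ℚ`-free `z ∈ (span_ℚ x)^m`, `m < n`,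
has `trdeg ℚ(z, e^z) + (n − m) + 1 ≤ trdeg ℚ(x, eˣ)`; in predimension terms `δ(span z) + 1 ≤ δ(span x)`
(`delta_succ_le_of_trdeg`, over `RootDecomp1HMirror.δ`).  No hypothesis on lower ranks: this is the engine that lets part 2
(`RootDecomp1HSigma`) prove the `σ`-presentability `SigmaPresentable` from Schanuel below `n` AT `σ`-STABLE TUPLES ONLY.

Sources: [cite: Kirby2010, Lemma 4.8, Prop. 7.2] (arXiv:0810.4285v1); [cite: Ax1971, Thm 3]; [cite: BaysKirby2018ANT, §4].
Lens seat (planner role), node g13; 0 sorry; axioms ⊆ [propext, Classical.choice, Quot.sound].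
-/

set_option linter.dupNamespace false

namespace Summit.Schanuel.Schanuel.Theorems.RootDecomp1HSigma

open Complex Set
open Literature.NumberTheory.Transcendental
open Literature.NumberTheory.Transcendental.GammaField
open Summit.Schanuel.Schanuel.Theses.RootDecomp1H
open Summit.Schanuel.Schanuel.Theorems.RootDecomp1HMirror

variable {n : ℕ}

/-! ## §1 Ax's theorem as the CONSTANTS ALTERNATIVE of the Khovanskii dichotomy (no hypothesis on lower ranks)

`khovanskii_or_constants` is the landed `MinimalCounterexampleInAcl.Negative.firstFailure_khovanskii` (Kirby 2010 Lemma 4.8 +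
Ax 1971 Thm 3 with its rank term + the tower law) with the two first-failure hypotheses REMOVED and the contradiction branch
returned as data: for a `ℚ`-free `x ∈ ℂⁿ`, either `(x, eˣ)` is a non-degenerate Khovanskii point of its own `ℚ`-locus, or there
is a `ℚ`-free tuple `z` of some length `m < n` INSIDE `span_ℚ x` (an integral basis of `span_ℚ x ∩ ker D`, `D ≠ 0` an
E-derivation of `ℚ(x, eˣ)`) with `trdeg ℚ(z, e^z) + (n − m) + 1 ≤ trdeg ℚ(x, eˣ)` — in predimension terms
`δ(span z) + 1 ≤ δ(span x)` (`delta_succ_le_of_trdeg`). -/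

set_option maxHeartbeats 1600000 in
/-- **Khovanskii point or Ax constants.**  For `ℚ`-free `x ∈ ℂⁿ`: either `n` `ℚ`-relations of `(x, eˣ)` with non-vanishing
exponential Jacobian exist, or for some `m < n`, `n' + m = n`, a `ℚ`-free `z ∈ (span_ℚ x)^m` has
`trdeg ℚ(z, e^z) + (n' + 1) ≤ trdeg ℚ(x, eˣ)`.  [cite: Kirby2010, Lemma 4.8; Ax1971, Thm 3] -/
theorem khovanskii_or_constants {n : ℕ} {x : Fin n → ℂ} (hxli : LinearIndependent ℚ x) :
    (∃ g : Fin n → MvPolynomial (Fin n ⊕ Fin n) ℚ,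
      (∀ i, MvPolynomial.aeval (Sum.elim x (cexp ∘ x)) (g i) = 0) ∧
      (Matrix.of fun i j => MvPolynomial.aeval (Sum.elim x (cexp ∘ x))
        (Khovanskii.ePD j (g i))).det ≠ 0) ∨
    ∃ m n' : ℕ, n' + m = n ∧ m < n ∧ ∃ z : Fin m → ℂ, LinearIndependent ℚ z ∧
      (∀ k, z k ∈ Submodule.span ℚ (range x)) ∧
      Algebra.trdeg ℚ ↥(IntermediateField.adjoin ℚ (range z ∪ range (cexp ∘ z))) + ((n' + 1 : ℕ) : Cardinal) ≤
        Algebra.trdeg ℚ ↥(IntermediateField.adjoin ℚ (range x ∪ range (cexp ∘ x))) := by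
  classical
  rcases Nat.eq_zero_or_pos n with rfl | hn
  · refine Or.inl ⟨fun _ => 0, fun i => i.elim0, ?_⟩
    rw [Matrix.det_isEmpty]
    exact one_ne_zero
  -- the field `L = ℚ(x̄, e^{x̄})`
  set S : Set ℂ := Set.range x ∪ Set.range (cexp ∘ x) with hS
  set L : IntermediateField ℚ ℂ := IntermediateField.adjoin ℚ S with hL
  have hxS : ∀ i, x i ∈ L := fun i => IntermediateField.subset_adjoin ℚ S (Or.inl ⟨i, rfl⟩)
  have hyS : ∀ i, cexp (x i) ∈ L := fun i => IntermediateField.subset_adjoin ℚ S (Or.inr ⟨i, rfl⟩)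
  set xL : Fin n → L := fun i => ⟨x i, hxS i⟩ with hxL
  set yL : Fin n → L := fun i => ⟨cexp (x i), hyS i⟩ with hyL
  have hy0 : ∀ i, yL i ≠ 0 := fun i h => Complex.exp_ne_zero (x i) (congrArg Subtype.val h)
  have htopL : IntermediateField.adjoin ℚ (Set.range xL ∪ Set.range yL) = ⊤ := by
    have h := IntermediateField.adjoin_preimage_val_eq_top (F := ℚ) S
    have hpre : Set.range xL ∪ Set.range yL = ((↑) : L → ℂ) ⁻¹' S := by
      ext t
      simp only [Set.mem_union, Set.mem_range, Set.mem_preimage, hS, Function.comp_apply]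
      constructor
      · rintro (⟨i, rfl⟩ | ⟨i, rfl⟩)
        · exact Or.inl ⟨i, rfl⟩
        · exact Or.inr ⟨i, rfl⟩
      · rintro (⟨i, hi⟩ | ⟨i, hi⟩)
        · exact Or.inl ⟨i, Subtype.ext hi⟩
        · exact Or.inr ⟨i, Subtype.ext hi⟩
    rw [hpre]
    exact h
  set zL : Fin n ⊕ Fin n → L := Sum.elim xL yL with hzL
  have hpt : Sum.elim x (cexp ∘ x) = algebraMap L ℂ ∘ zL := by
    funext s; rcases s with i | i <;> rfl
  have heval : ∀ p : MvPolynomial (Fin n ⊕ Fin n) ℚ,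
      MvPolynomial.aeval (Sum.elim x (cexp ∘ x)) p = algebraMap L ℂ (MvPolynomial.aeval zL p) := by
    intro p
    rw [hpt, MvPolynomial.aeval_algebraMap_apply]
  rcases khovanskii_dichotomy xL yL htopL with ⟨g, hg0, hdet⟩ | ⟨D, hDE, j₀, hj₀⟩
  · /- (a) a Khovanskii system over ℚ: transport to ℂ -/
    simp only [← hzL] at hg0 hdet
    refine Or.inl ⟨g, fun i => ?_, ?_⟩
    · rw [heval, hg0 i, map_zero]
    · have hJ : (Matrix.of fun i j => MvPolynomial.aeval (Sum.elim x (cexp ∘ x))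
          (Khovanskii.ePD j (g i))) =
          (algebraMap L ℂ).mapMatrix (Matrix.of fun i j => MvPolynomial.aeval zL (Khovanskii.ePD j (g i))) := by
        ext i j
        simp only [Matrix.of_apply, RingHom.mapMatrix_apply, Matrix.map_apply]
        rw [heval]
      rw [hJ, ← RingHom.map_det, map_ne_zero]
      exact hdet
  · /- (b) a non-zero E-derivation `D` of `L` over `ℚ`: Ax's theorem on its constants -/
    refine Or.inr ?_
    set Dz : Derivation ℤ L L := D.restrictScalars ℤ with hDz
    set D1 : Fin 1 → Derivation ℤ L L := fun _ => Dz with hD1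
    set CD : Subring L := constantSubring D1 with hCD
    have hmemCD : ∀ a : L, a ∈ CD ↔ D a = 0 := fun a => by
      simp only [hCD, hD1, hDz, mem_constantSubring, forall_const]
      exact Iff.rfl
    have hFCD : ∀ c : ℚ, algebraMap ℚ L c ∈ CD := fun c => (hmemCD _).mpr (D.map_algebraMap c)
    -- the elements of `L` killed by `D`, as a `ℚ`-subspace `N` of `ℂ`
    set N : Submodule ℚ ℂ :=
      (LinearMap.ker (D : L →ₗ[ℚ] L)).map (IsScalarTower.toAlgHom ℚ L ℂ).toLinearMap with hN
    have hmemN : ∀ a : ℂ, a ∈ N ↔ ∃ l : L, D l = 0 ∧ (l : ℂ) = a := fun a => by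
      simp only [hN, Submodule.mem_map, LinearMap.mem_ker]
      constructor
      · rintro ⟨l, hl, rfl⟩; exact ⟨l, hl, rfl⟩
      · rintro ⟨l, hl, rfl⟩; exact ⟨l, hl, rfl⟩
    -- the dependence space `V = {q ∈ ℚⁿ | q·x̄ ∈ N}` and the splitting `n = n' + m`
    set T : (Fin n → ℚ) →ₗ[ℚ] ℂ := Fintype.linearCombination ℚ x with hT
    have hTapply : ∀ v : Fin n → ℚ, T v = ∑ i, v i • x i := fun v =>
      Fintype.linearCombination_apply ℚ x v
    set V : Submodule ℚ (Fin n → ℚ) := N.comap T with hV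
    set T' : (Fin n → ℚ) →ₗ[ℚ] ℂ ⧸ N := N.mkQ ∘ₗ T with hT'
    have hker : LinearMap.ker T' = V := by rw [hT', LinearMap.ker_comp, Submodule.ker_mkQ]
    obtain ⟨κ, a, ha, hspan, hli⟩ := exists_linearIndependent' ℚ ((Submodule.mkQ N) ∘ x)
    haveI : Fintype κ := Fintype.ofInjective a ha
    set n' := Fintype.card κ with hn'
    set e := Fintype.equivFin κ with he
    have hrange : Module.finrank ℚ (LinearMap.range T') = n' := by
      have h1 : LinearMap.range T' = Submodule.span ℚ (Set.range (N.mkQ ∘ x)) := by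
        rw [hT', LinearMap.range_comp, hT, Fintype.range_linearCombination, Submodule.map_span,
          ← Set.range_comp]
      rw [h1, ← hspan, finrank_span_eq_card hli]
    set m := Module.finrank ℚ V with hm
    have hnm : n' + m = n := by
      have := LinearMap.finrank_range_add_finrank_ker T'
      rwa [hrange, hker, Module.finrank_fin_fun] at this
    -- `x j₀ ∉ N`
    have hxj₀N : x j₀ ∉ N := by
      intro hmem
      obtain ⟨l, hl0, hl⟩ := (hmemN _).mp hmem
      have hlx : l = xL j₀ := Subtype.ext hl
      rw [hlx] at hl0
      exact hj₀ hl0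
    have hmn : m < n := by
      by_contra hmn'
      have hmn2 : m = n := le_antisymm (by omega) (not_lt.mp hmn')
      have hVtop : V = ⊤ :=
        Submodule.eq_top_of_finrank_eq (by rw [← hm, hmn2, Module.finrank_fin_fun])
      have hmemV : (Pi.single j₀ (1 : ℚ) : Fin n → ℚ) ∈ V := hVtop ▸ Submodule.mem_top
      rw [hV, Submodule.mem_comap, hT, Fintype.linearCombination_apply_single, one_smul] at hmemV
      exact hxj₀N hmemV
    -- every element of the sub-tuple has `D ≠ 0`, and the sub-tuple is non-empty
    have hDx' : ∀ k : κ, D (xL (a k)) ≠ 0 := by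
      intro k hk
      have hmemN' : x (a k) ∈ N := (hmemN _).mpr ⟨xL (a k), hk, rfl⟩
      have h0 : ((Submodule.mkQ N) ∘ x ∘ a) k = 0 := by
        simp only [Function.comp_apply, Submodule.mkQ_apply, Submodule.Quotient.mk_eq_zero]
        exact hmemN'
      exact hli.ne_zero k h0
    have hn'pos : 0 < n' := by
      rw [hn', Fintype.card_pos_iff]
      by_contra hempty
      rw [not_nonempty_iff] at hempty
      have hbot : Submodule.span ℚ (Set.range (((Submodule.mkQ N) ∘ x) ∘ a)) = ⊥ := by
        rw [Set.range_eq_empty, Submodule.span_empty]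
      have hmem : (Submodule.mkQ N) (x j₀) ∈ Submodule.span ℚ (Set.range ((Submodule.mkQ N) ∘ x)) :=
        Submodule.subset_span ⟨j₀, rfl⟩
      rw [← hspan, hbot, Submodule.mem_bot, Submodule.mkQ_apply, Submodule.Quotient.mk_eq_zero] at hmem
      exact hxj₀N hmem
    -- Ax's theorem, WITH the rank term, for the sub-tuple
    set x' : Fin n' → L := fun i => xL (a (e.symm i)) with hx'
    set y' : Fin n' → L := fun i => yL (a (e.symm i)) with hy'
    have hind : IsQLinearIndependentMod D1 x' := by
      intro q hq
      have hD0 : D (∑ i, (q i : L) * x' i) = 0 := (hmemCD _).mp hq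
      have hNmem : (∑ i, ((q i : ℚ)) • x (a (e.symm i))) ∈ N := by
        refine (hmemN _).mpr ⟨_, hD0, ?_⟩
        rw [show (∑ i, ((q i : ℚ)) • x (a (e.symm i))) = ∑ i, (q i : ℂ) * x (a (e.symm i)) from
          Finset.sum_congr rfl fun i _ => by rw [Rat.smul_def, Rat.cast_intCast]]
        push_cast
        simp only [hx', hxL]
      have h0 : ∑ i, ((q i : ℤ) : ℚ) • ((N.mkQ ∘ x ∘ a) ∘ e.symm) i = 0 := by
        have h1 : N.mkQ (∑ i, ((q i : ℚ)) • x (a (e.symm i))) = 0 :=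
          (Submodule.Quotient.mk_eq_zero N).mpr hNmem
        rw [map_sum] at h1
        simpa only [map_smul, Function.comp_apply] using h1
      have hli' : LinearIndependent ℚ ((N.mkQ ∘ x ∘ a) ∘ e.symm) := hli.comp e.symm e.symm.injective
      have h2 := Fintype.linearIndependent_iff.mp hli' _ h0
      funext i
      exact_mod_cast h2 i
    have hrank1 : 1 ≤ (Matrix.of fun i j => D1 j (x' i)).rank := by
      rw [Matrix.rank]
      by_contra hlt
      push Not at hlt
      have hbot : LinearMap.range (Matrix.of fun i j => D1 j (x' i)).mulVecLin = ⊥ :=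
        Submodule.finrank_eq_zero.1 (Nat.lt_one_iff.1 hlt)
      have hmem : (Matrix.of fun i j => D1 j (x' i)).mulVecLin (Pi.single 0 1) ∈
          LinearMap.range (Matrix.of fun i j => D1 j (x' i)).mulVecLin := LinearMap.mem_range_self _ _
      rw [hbot, Submodule.mem_bot, Matrix.mulVecLin_apply, Matrix.mulVec_single_one] at hmem
      have h := congrFun hmem ⟨0, hn'pos⟩
      simp only [Matrix.col_apply, Matrix.of_apply, Pi.zero_apply, hD1, hDz,
        Derivation.restrictScalars_apply] at h
      exact hDx' _ h
    have hAxL' := ax_schanuel_holds L 1 n' D1 x' y' (fun i => hy0 _)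
      (fun _ i => hDE (a (e.symm i))) hind
    letI algCD : Algebra CD L := Algebra.ofSubsemiring CD.toSubsemiring
    have h1 : ((n' + 1 : ℕ) : Cardinal) ≤ Algebra.trdeg CD L := by
      have h2 : ((n' + 1 : ℕ) : Cardinal) ≤ ((n' + (Matrix.of fun i j => D1 j (x' i)).rank : ℕ) : Cardinal) := by
        exact_mod_cast (by omega : n' + 1 ≤ n' + (Matrix.of fun i j => D1 j (x' i)).rank)
      exact (h2.trans hAxL').trans (trdeg_le_of_injective (Subalgebra.val _) Subtype.val_injective)
    -- an integral basis of `V` and the tuple `z̄ = (w_k · x̄)_k`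
    haveI : Module.Free ℚ ↥V := Module.Free.of_divisionRing ℚ ↥V
    haveI : Module.Finite ℚ ↥V := Module.IsNoetherian.finite ℚ ↥V
    let bV := Module.finBasis ℚ V
    have hint : ∀ k : Fin m, ∃ d : ℕ, d ≠ 0 ∧ ∃ w : Fin n → ℤ,
        ∀ i, (d : ℚ) * ((bV k : V) : Fin n → ℚ) i = w i := fun k => exists_nat_mul_eq_intCast _
    choose d hd w hw using hint
    have huV : ∀ k, (fun i => (w k i : ℚ)) ∈ V := fun k => by
      have : (fun i => (w k i : ℚ)) = (d k : ℚ) • ((bV k : V) : Fin n → ℚ) := by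
        funext i; rw [Pi.smul_apply, smul_eq_mul, hw]
      rw [this]
      exact V.smul_mem _ (bV k).2
    have hli_u : LinearIndependent ℚ (fun k => fun i => (w k i : ℚ)) := by
      have hb : LinearIndependent ℚ (fun k => ((bV k : V) : Fin n → ℚ)) :=
        bV.linearIndependent.map' V.subtype (Submodule.ker_subtype V)
      have hb2 := hb.units_smul fun k => Units.mk0 (d k : ℚ) (Nat.cast_ne_zero.mpr (hd k))
      convert hb2 using 1
      funext k i
      change (w k i : ℚ) = ((Units.mk0 (d k : ℚ) (Nat.cast_ne_zero.mpr (hd k))) •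
        ((bV k : V) : Fin n → ℚ)) i
      rw [Units.smul_def, Units.val_mk0, Pi.smul_apply, smul_eq_mul, hw]
    set z : Fin m → ℂ := fun k => ∑ i, (w k i : ℂ) * x i with hz
    -- `z̄` is ℚ-linearly independent (`x̄` is, and the rows `w_k` are)
    have hzli : LinearIndependent ℚ z := by
      rw [Fintype.linearIndependent_iff]
      intro c hc k
      have hsum : (∑ k, c k • z k) = ∑ i, (∑ k, c k * (w k i : ℚ)) • x i := by
        simp only [hz, Rat.smul_def, Finset.mul_sum]
        rw [Finset.sum_comm]
        refine Finset.sum_congr rfl fun i _ => ?_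
        push_cast
        rw [Finset.sum_mul]
        refine Finset.sum_congr rfl fun k _ => ?_
        ring
      rw [hsum] at hc
      have hcoef := (Fintype.linearIndependent_iff.1 hxli) _ hc
      have hvec : (∑ k, c k • fun i => (w k i : ℚ)) = 0 := by
        funext i
        simp only [Finset.sum_apply, Pi.smul_apply, smul_eq_mul, Pi.zero_apply]
        exact hcoef i
      exact (Fintype.linearIndependent_iff.1 hli_u) c hvec k
    -- `z̄ ⊂ span_ℚ x̄`
    have hzx : ∀ k, z k ∈ Submodule.span ℚ (range x) := fun k => by
      refine Submodule.sum_mem _ fun i _ => ?_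
      rw [← zsmul_eq_mul]
      exact zsmul_mem (Submodule.subset_span (Set.mem_range_self i) : x i ∈ Submodule.span ℚ (range x)) _
    -- `z_k ∈ L` and `e^{z_k} ∈ L` are killed by `D`
    set zLk : Fin m → L := fun k => ∑ i, (w k i : L) * xL i with hzLk
    have hzcoe : ∀ k, ((zLk k : L) : ℂ) = z k := fun k => by
      simp only [hzLk, hz, hxL]
      push_cast
      rfl
    have hDz0 : ∀ k, D (zLk k) = 0 := fun k => by
      obtain ⟨l, hl0, hl⟩ := (hmemN _).mp (Submodule.mem_comap.mp (huV k))
      have hTz : T (fun i => (w k i : ℚ)) = z k := by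
        rw [hTapply, hz]
        exact Finset.sum_congr rfl fun i _ => by rw [Rat.smul_def, Rat.cast_intCast]
      have hl' : l = zLk k := Subtype.ext (by rw [hl, hTz, hzcoe])
      rw [← hl']
      exact hl0
    set ezLk : Fin m → L := fun k => ∏ i, yL i ^ w k i with hezLk
    have hezcoe : ∀ k, ((ezLk k : L) : ℂ) = cexp (z k) := fun k => by
      rw [hz]
      dsimp only
      rw [Complex.exp_sum]
      simp only [hezLk, hyL]
      push_cast
      refine Finset.prod_congr rfl fun i _ => ?_
      rw [Complex.exp_int_mul]
      exact map_zpow₀ (algebraMap (↥L) ℂ) _ _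
    have hDez0 : ∀ k, D (ezLk k) = 0 := fun k => by
      simp only [hezLk]
      rw [derivation_prod_zpow_of_exp D xL yL hy0 hDE (w k)]
      have : D (∑ i, (w k i : L) * xL i) = 0 := hDz0 k
      rw [this, mul_zero]
    set Sz : Set ℂ := Set.range z ∪ Set.range (cexp ∘ z) with hSz
    set Nz : IntermediateField ℚ ℂ := IntermediateField.adjoin ℚ Sz with hNz
    have hle : Nz ≤ L := by
      rw [hNz, IntermediateField.adjoin_le_iff]
      rintro t (⟨k, rfl⟩ | ⟨k, rfl⟩)
      · rw [← hzcoe]; exact (zLk k).2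
      · simp only [Function.comp_apply]; rw [← hezcoe]; exact (ezLk k).2
    have hιE : ∀ (t : ℂ) (ht : t ∈ Nz), (⟨t, hle ht⟩ : L) ∈ CD := by
      intro t ht
      rw [hmemCD]
      induction ht using IntermediateField.adjoin_induction with
      | mem t ht =>
        rcases ht with ⟨k, rfl⟩ | ⟨k, rfl⟩
        · have h' : (⟨z k, hle (IntermediateField.subset_adjoin ℚ Sz (Or.inl ⟨k, rfl⟩))⟩ : L) =
              zLk k := Subtype.ext (hzcoe k).symm
          rw [h']; exact hDz0 k
        · have h' : (⟨(cexp ∘ z) k, hle (IntermediateField.subset_adjoin ℚ Sz (Or.inr ⟨k, rfl⟩))⟩ : L) =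
              ezLk k := Subtype.ext (hezcoe k).symm
          rw [h']; exact hDez0 k
      | algebraMap c => exact D.map_algebraMap c
      | add s t hs ht ihs iht =>
        have h' : (⟨s + t, hle (add_mem hs ht)⟩ : L) = ⟨s, hle hs⟩ + ⟨t, hle ht⟩ := rfl
        rw [h', map_add, ihs, iht, add_zero]
      | inv s hs ihs =>
        have h' : (⟨s⁻¹, hle (inv_mem hs)⟩ : L) = (⟨s, hle hs⟩)⁻¹ := rfl
        rw [h', Derivation.leibniz_inv, ihs, smul_zero]
      | mul s t hs ht ihs iht =>
        have h' : (⟨s * t, hle (mul_mem hs ht)⟩ : L) = ⟨s, hle hs⟩ * ⟨t, hle ht⟩ := rfl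
        rw [h', Derivation.leibniz, ihs, iht, smul_zero, smul_zero, add_zero]
    -- assembling: `trdeg_ℚ Nz + (n' + 1) ≤ trdeg_ℚ Nz + trdeg_CD L ≤ trdeg_ℚ L`
    have htower := trdeg_add_le_of_le_subring L Nz hle CD hFCD hιE
    refine ⟨m, n', hnm, hmn, z, hzli, hzx, ?_⟩
    calc Algebra.trdeg ℚ ↥Nz + ((n' + 1 : ℕ) : Cardinal)
        ≤ Algebra.trdeg ℚ ↥Nz + Algebra.trdeg CD L := by gcongr
      _ ≤ Algebra.trdeg ℚ ↥L := htower

/-! ## §1b The predimension reading of the constants alternative: `δ(span z) + 1 ≤ δ(span x)` -/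


/-- From `trdeg ℚ(z, e^z) + k ≤ trdeg ℚ(x, eˣ)` with `m + k = n + 1` to `δ(span z) + 1 ≤ δ(span x)`. -/
theorem delta_succ_le_of_trdeg {m n k : ℕ} {z : Fin m → ℂ} {x : Fin n → ℂ} (hz : LinearIndependent ℚ z)
    (hx : LinearIndependent ℚ x) (hk : m + k = n + 1)
    (H : Algebra.trdeg ℚ ↥(IntermediateField.adjoin ℚ (range z ∪ range (cexp ∘ z))) + (k : Cardinal) ≤
      Algebra.trdeg ℚ ↥(IntermediateField.adjoin ℚ (range x ∪ range (cexp ∘ x)))) :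
    δ (Submodule.span ℚ (range z)) + 1 ≤ δ (Submodule.span ℚ (range x)) := by
  simp only [δ, predim_bot_span_range hz, predim_bot_span_range hx]
  set a := (algMatroid ℂ).eRk (range z ∪ range (cexp ∘ z)) with ha
  set b := (algMatroid ℂ).eRk (range x ∪ range (cexp ∘ x)) with hb
  have ha' : a = (a.toNat : ℕ∞) := (ENat.coe_toNat (eRk_range_ne_top z)).symm
  have hb' : b = (b.toNat : ℕ∞) := (ENat.coe_toNat (eRk_range_ne_top x)).symm
  -- `a.toNat ≤ trdeg ℚ(z, e^z)`
  have h1 : ((a.toNat : ℕ) : Cardinal) ≤ Algebra.trdeg ℚ ↥(IntermediateField.adjoin ℚ (range z ∪ range (cexp ∘ z))) :=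
    (natCast_le_trdeg_iff z a.toNat).2 ha'.symm.le
  -- hence `a.toNat + k ≤ trdeg ℚ(x, eˣ)`, i.e. `a.toNat + k ≤ b.toNat`
  have h2 : (((a.toNat + k : ℕ)) : Cardinal) ≤ Algebra.trdeg ℚ ↥(IntermediateField.adjoin ℚ (range x ∪ range (cexp ∘ x))) := by
    have : (((a.toNat + k : ℕ)) : Cardinal) = ((a.toNat : ℕ) : Cardinal) + (k : Cardinal) := by push_cast; rfl
    rw [this]
    exact (add_le_add h1 le_rfl).trans H
  have h3 : ((a.toNat + k : ℕ) : ℕ∞) ≤ b := (natCast_le_trdeg_iff x _).1 h2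
  rw [hb'] at h3
  have h4 : a.toNat + k ≤ b.toNat := by exact_mod_cast h3
  omega

end Summit.Schanuel.Schanuel.Theorems.RootDecomp1HSigma
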